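import Summits.Parity.BatemanHorn.Theorems.AlmostPrimeZerosSystemLSDRealSegmentRealForm
import HarnessLib

/-!
# `SystemLSDRealSegment` (stmt-Parity-11292), line `beta-thinned-root-kernel`: localisation of the kernel law
# to ROUGH divisor tuples (lead c9)

The open content of the crux is the kernel law `BetaKernelLaw k f y` (beyond-level-`x` divisor tuples `d`,
`∏ dᵢ > x`, weights `∏ h_y(dᵢ) ≥ 0`).  Split the kernel at a smoothness height `S`:
`K_x(y) = K^{sm}_x(y; S) + K^{rough}_x(y; S)`, the first over the tuples whose product `∏ dᵢ` is `S`-smooth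
(all prime factors `< S`, `Nat.smoothNumbers S`), the second over the remaining ("rough") tuples, which carry a
prime factor `≥ S`.  With `S = ⌊x^θ⌋₊ + 1` (primes `≤ x^θ`):

* `kernelSum_eq_smooth_add_rough` — the split is exact; both parts are `≥ 0` for `y ≥ 1`.
* `betaKernelLaw_of_roughLaw` — IF the smooth part is negligible in the form
  `K^{sm}_x(y; ⌊x^θ⌋₊+1) ≤ C e^{−1/θ} · x (log x)^{k(y−1)}` (all `θ ∈ (0,1]`, all large `x`; PROVED for every
  Bateman–Horn system in the files `…SmoothKernel*`, Rankin's trick + Nair–Tenenbaum light) AND the rough part obeys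
  the law up to `ε` for all small `θ`
  (`∀ ε > 0 ∃ θ₀ > 0 ∀ θ ∈ (0, θ₀]: |K^{rough}_x(y; ⌊x^θ⌋₊+1)/(x (log x)^{k(y−1)}) − ℓ_f(y)| ≤ ε` eventually,
  `ℓ_f(y) = Re λ_f(y)·(e^{(y−1) log D} Γ(y)^{−k} − Γ(k(y−1)+1)^{−1})`), THEN `BetaKernelLaw k f y`.
* `roughLaw_of_betaKernelLaw` — the converse: under the same smooth bound, the kernel law implies the rough law.

So each class stub of the line is EXACTLY the `y`-tilted law of the prime factors `> x^θ` of the values `fᵢ(n)`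
(one small `θ` suffices, every smaller `θ` must agree), the smooth bookkeeping being discharged unconditionally.
Everything here is PROVED; no definitions (the two kernel parts are written as explicit filtered sums).
-/

open Filter Finset Polynomial
open scoped BigOperators Topology

namespace Summit.Parity.BatemanHorn.Cruxes.SystemLSDRealSegment.BetaThinnedRootKernel

open Literature.NumberTheory.Sieve

noncomputable section

variable {k : ℕ}

/-! ### The split of the kernel at a smoothness height -/

/-- **Exact split of the kernel** at any smoothness height `S`:
`K_x(y) = Σ_n Σ_{d : ∏dᵢ > x, ∏dᵢ S-smooth} ∏h_y(dᵢ) + Σ_n Σ_{d : ∏dᵢ > x, ∏dᵢ not S-smooth} ∏h_y(dᵢ)`. [folklore] -/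
theorem kernelSum_eq_smooth_add_rough (f : Fin k → ℤ[X]) (y : ℝ) (S x : ℕ) :
    kernelSum f y x =
      (∑ n ∈ range (x + 1), ∑ d ∈ (tuples f n).filter
          (fun d => x < ∏ i, d i ∧ (∏ i, d i) ∈ Nat.smoothNumbers S), ∏ i, thinWeight y (d i)) +
      (∑ n ∈ range (x + 1), ∑ d ∈ (tuples f n).filter
          (fun d => x < ∏ i, d i ∧ (∏ i, d i) ∉ Nat.smoothNumbers S), ∏ i, thinWeight y (d i)) := by
  rw [kernelSum, ← Finset.sum_add_distrib]
  refine Finset.sum_congr rfl fun n _ => ?_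
  rw [← Finset.filter_filter, ← Finset.filter_filter, Finset.sum_filter_add_sum_filter_not]

/-- The smooth part of the kernel is `≥ 0` for `y ≥ 1`. [folklore] -/
theorem smoothKernel_nonneg (f : Fin k → ℤ[X]) {y : ℝ} (hy : 1 ≤ y) (S x : ℕ) :
    0 ≤ ∑ n ∈ range (x + 1), ∑ d ∈ (tuples f n).filter
        (fun d => x < ∏ i, d i ∧ (∏ i, d i) ∈ Nat.smoothNumbers S), ∏ i, thinWeight y (d i) :=
  Finset.sum_nonneg fun _ _ => Finset.sum_nonneg fun d _ => prod_thinWeight_nonneg hy d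

/-- The rough part of the kernel is `≥ 0` for `y ≥ 1`. [folklore] -/
theorem roughKernel_nonneg (f : Fin k → ℤ[X]) {y : ℝ} (hy : 1 ≤ y) (S x : ℕ) :
    0 ≤ ∑ n ∈ range (x + 1), ∑ d ∈ (tuples f n).filter
        (fun d => x < ∏ i, d i ∧ (∏ i, d i) ∉ Nat.smoothNumbers S), ∏ i, thinWeight y (d i) :=
  Finset.sum_nonneg fun _ _ => Finset.sum_nonneg fun d _ => prod_thinWeight_nonneg hy d

/-! ### Elementary: `e^{−1/θ} ≤ θ` -/

/-- `exp(−1/θ) ≤ θ` for `θ > 0` (from `1 + 1/θ ≤ exp(1/θ)`). [folklore] -/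
theorem exp_neg_inv_le {θ : ℝ} (hθ : 0 < θ) : Real.exp (-1 / θ) ≤ θ := by
  have h1 : 1 / θ + 1 ≤ Real.exp (1 / θ) := Real.add_one_le_exp _
  have h2 : 0 < 1 / θ := by positivity
  rw [neg_div, Real.exp_neg, inv_le_comm₀ (Real.exp_pos _) hθ]
  calc θ⁻¹ = 1 / θ := (one_div θ).symm
    _ ≤ 1 / θ + 1 := by linarith
    _ ≤ Real.exp (1 / θ) := h1

/-! ### The kernel law from the rough law -/

/-- **The kernel law from the rough law.**  For a Bateman–Horn system `f` and real `y ≥ 1`: if the SMOOTH part of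
the kernel at height `⌊x^θ⌋₊ + 1` is `≤ C e^{−1/θ} x (log x)^{k(y−1)}` for every `θ ∈ (0, 1]` and all large `x`, and the
ROUGH part obeys the kernel law up to every `ε > 0` for all sufficiently small `θ`, then `BetaKernelLaw k f y`.
[folklore] -/
theorem betaKernelLaw_of_roughLaw {f : Fin k → ℤ[X]} (hf : IsBatemanHornSystem f) {y : ℝ} (hy : 1 ≤ y)
    (hS : ∃ C : ℝ, ∀ θ : ℝ, 0 < θ → θ ≤ 1 → ∀ᶠ x : ℕ in atTop,
      (∑ n ∈ range (x + 1), ∑ d ∈ (tuples f n).filter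
          (fun d => x < ∏ i, d i ∧ (∏ i, d i) ∈ Nat.smoothNumbers (⌊(x : ℝ) ^ θ⌋₊ + 1)),
            ∏ i, thinWeight y (d i)) ≤
        C * Real.exp (-1 / θ) * ((x : ℝ) * Real.log x ^ ((k : ℝ) * (y - 1))))
    (hR : ∀ ε : ℝ, 0 < ε → ∃ θ₀ : ℝ, 0 < θ₀ ∧ ∀ θ : ℝ, 0 < θ → θ ≤ θ₀ → ∀ᶠ x : ℕ in atTop,
      |(∑ n ∈ range (x + 1), ∑ d ∈ (tuples f n).filter
          (fun d => x < ∏ i, d i ∧ (∏ i, d i) ∉ Nat.smoothNumbers (⌊(x : ℝ) ^ θ⌋₊ + 1)),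
            ∏ i, thinWeight y (d i)) / ((x : ℝ) * Real.log x ^ ((k : ℝ) * (y - 1))) -
        (eulerFactor f (y : ℂ)).re *
          (Real.exp ((y - 1) * Real.log (∏ i, ((f i).natDegree : ℝ))) * (Real.Gamma y)⁻¹ ^ k -
            (Real.Gamma ((k : ℝ) * (y - 1) + 1))⁻¹)| ≤ ε) :
    BetaKernelLaw k f y := by
  rw [betaKernelLaw_iff_tendsto_real hf hy]
  set ℓ : ℝ := (eulerFactor f (y : ℂ)).re *
    (Real.exp ((y - 1) * Real.log (∏ i, ((f i).natDegree : ℝ))) * (Real.Gamma y)⁻¹ ^ k -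
      (Real.Gamma ((k : ℝ) * (y - 1) + 1))⁻¹) with hℓ
  obtain ⟨C, hC⟩ := hS
  set C' : ℝ := max C 1 with hC'
  have hC'0 : 0 < C' := lt_of_lt_of_le one_pos (le_max_right _ _)
  rw [Metric.tendsto_nhds]
  intro ε hε
  obtain ⟨θ₀, hθ₀, hθ⟩ := hR (ε / 3) (by positivity)
  set θ : ℝ := min θ₀ (min 1 (ε / (3 * C'))) with hθdef
  have hθpos : 0 < θ := lt_min hθ₀ (lt_min one_pos (by positivity))
  have hθ₀' : θ ≤ θ₀ := min_le_left _ _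
  have hθ1 : θ ≤ 1 := (min_le_right _ _).trans (min_le_left _ _)
  have hθε : θ ≤ ε / (3 * C') := (min_le_right _ _).trans (min_le_right _ _)
  have hsmall : C' * Real.exp (-1 / θ) ≤ ε / 3 := by
    calc C' * Real.exp (-1 / θ) ≤ C' * θ := mul_le_mul_of_nonneg_left (exp_neg_inv_le hθpos) hC'0.le
      _ ≤ C' * (ε / (3 * C')) := mul_le_mul_of_nonneg_left hθε hC'0.le
      _ = ε / 3 := by field_simp
  filter_upwards [hC θ hθpos hθ1, hθ θ hθpos hθ₀', eventually_ge_atTop 2] with x hxS hxR hx2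
  have hx2' : (2 : ℝ) ≤ x := by exact_mod_cast hx2
  set N : ℝ := (x : ℝ) * Real.log x ^ ((k : ℝ) * (y - 1)) with hN
  have hNpos : 0 < N := mul_pos (by linarith) (Real.rpow_pos_of_pos (Real.log_pos (by linarith)) _)
  set A : ℝ := ∑ n ∈ range (x + 1), ∑ d ∈ (tuples f n).filter
      (fun d => x < ∏ i, d i ∧ (∏ i, d i) ∈ Nat.smoothNumbers (⌊(x : ℝ) ^ θ⌋₊ + 1)),
        ∏ i, thinWeight y (d i) with hA
  set B : ℝ := ∑ n ∈ range (x + 1), ∑ d ∈ (tuples f n).filter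
      (fun d => x < ∏ i, d i ∧ (∏ i, d i) ∉ Nat.smoothNumbers (⌊(x : ℝ) ^ θ⌋₊ + 1)),
        ∏ i, thinWeight y (d i) with hB
  have hA0 : 0 ≤ A := smoothKernel_nonneg f hy _ x
  have hsplit : kernelSum f y x = A + B := kernelSum_eq_smooth_add_rough f y _ x
  have hAle : A ≤ C' * Real.exp (-1 / θ) * N :=
    hxS.trans (mul_le_mul_of_nonneg_right
      (mul_le_mul_of_nonneg_right (le_max_left _ _) (Real.exp_pos _).le) hNpos.le)
  have hAN : A / N ≤ ε / 3 := by
    rw [div_le_iff₀ hNpos]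
    calc A ≤ C' * Real.exp (-1 / θ) * N := hAle
      _ ≤ ε / 3 * N := mul_le_mul_of_nonneg_right hsmall hNpos.le
  have hAN0 : 0 ≤ A / N := div_nonneg hA0 hNpos.le
  rw [Real.dist_eq, hsplit, add_div]
  calc |A / N + B / N - ℓ| = |(B / N - ℓ) + A / N| := by ring_nf
    _ ≤ |B / N - ℓ| + |A / N| := abs_add_le _ _
    _ ≤ ε / 3 + ε / 3 := add_le_add hxR (by rw [abs_of_nonneg hAN0]; exact hAN)
    _ < ε := by linarith

/-- **The rough law from the kernel law** (converse of `betaKernelLaw_of_roughLaw`): under the same smooth bound,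
`BetaKernelLaw k f y` implies that the rough part obeys the law up to every `ε > 0` for all small `θ`. [folklore] -/
theorem roughLaw_of_betaKernelLaw {f : Fin k → ℤ[X]} (hf : IsBatemanHornSystem f) {y : ℝ} (hy : 1 ≤ y)
    (hS : ∃ C : ℝ, ∀ θ : ℝ, 0 < θ → θ ≤ 1 → ∀ᶠ x : ℕ in atTop,
      (∑ n ∈ range (x + 1), ∑ d ∈ (tuples f n).filter
          (fun d => x < ∏ i, d i ∧ (∏ i, d i) ∈ Nat.smoothNumbers (⌊(x : ℝ) ^ θ⌋₊ + 1)),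
            ∏ i, thinWeight y (d i)) ≤
        C * Real.exp (-1 / θ) * ((x : ℝ) * Real.log x ^ ((k : ℝ) * (y - 1))))
    (hK : BetaKernelLaw k f y) :
    ∀ ε : ℝ, 0 < ε → ∃ θ₀ : ℝ, 0 < θ₀ ∧ ∀ θ : ℝ, 0 < θ → θ ≤ θ₀ → ∀ᶠ x : ℕ in atTop,
      |(∑ n ∈ range (x + 1), ∑ d ∈ (tuples f n).filter
          (fun d => x < ∏ i, d i ∧ (∏ i, d i) ∉ Nat.smoothNumbers (⌊(x : ℝ) ^ θ⌋₊ + 1)),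
            ∏ i, thinWeight y (d i)) / ((x : ℝ) * Real.log x ^ ((k : ℝ) * (y - 1))) -
        (eulerFactor f (y : ℂ)).re *
          (Real.exp ((y - 1) * Real.log (∏ i, ((f i).natDegree : ℝ))) * (Real.Gamma y)⁻¹ ^ k -
            (Real.Gamma ((k : ℝ) * (y - 1) + 1))⁻¹)| ≤ ε := by
  rw [betaKernelLaw_iff_tendsto_real hf hy] at hK
  set ℓ : ℝ := (eulerFactor f (y : ℂ)).re *
    (Real.exp ((y - 1) * Real.log (∏ i, ((f i).natDegree : ℝ))) * (Real.Gamma y)⁻¹ ^ k -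
      (Real.Gamma ((k : ℝ) * (y - 1) + 1))⁻¹) with hℓ
  obtain ⟨C, hC⟩ := hS
  set C' : ℝ := max C 1 with hC'
  have hC'0 : 0 < C' := lt_of_lt_of_le one_pos (le_max_right _ _)
  intro ε hε
  refine ⟨min 1 (ε / (2 * C')), lt_min one_pos (by positivity), fun θ hθpos hθle => ?_⟩
  have hθ1 : θ ≤ 1 := hθle.trans (min_le_left _ _)
  have hθε : θ ≤ ε / (2 * C') := hθle.trans (min_le_right _ _)
  have hsmall : C' * Real.exp (-1 / θ) ≤ ε / 2 := by
    calc C' * Real.exp (-1 / θ) ≤ C' * θ := mul_le_mul_of_nonneg_left (exp_neg_inv_le hθpos) hC'0.le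
      _ ≤ C' * (ε / (2 * C')) := mul_le_mul_of_nonneg_left hθε hC'0.le
      _ = ε / 2 := by field_simp
  have hK' := (Metric.tendsto_nhds.1 hK) (ε / 2) (by positivity)
  filter_upwards [hC θ hθpos hθ1, hK', eventually_ge_atTop 2] with x hxS hxK hx2
  have hx2' : (2 : ℝ) ≤ x := by exact_mod_cast hx2
  set N : ℝ := (x : ℝ) * Real.log x ^ ((k : ℝ) * (y - 1)) with hN
  have hNpos : 0 < N := mul_pos (by linarith) (Real.rpow_pos_of_pos (Real.log_pos (by linarith)) _)
  set A : ℝ := ∑ n ∈ range (x + 1), ∑ d ∈ (tuples f n).filter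
      (fun d => x < ∏ i, d i ∧ (∏ i, d i) ∈ Nat.smoothNumbers (⌊(x : ℝ) ^ θ⌋₊ + 1)),
        ∏ i, thinWeight y (d i) with hA
  set B : ℝ := ∑ n ∈ range (x + 1), ∑ d ∈ (tuples f n).filter
      (fun d => x < ∏ i, d i ∧ (∏ i, d i) ∉ Nat.smoothNumbers (⌊(x : ℝ) ^ θ⌋₊ + 1)),
        ∏ i, thinWeight y (d i) with hB
  have hA0 : 0 ≤ A := smoothKernel_nonneg f hy _ x
  have hsplit : kernelSum f y x = A + B := kernelSum_eq_smooth_add_rough f y _ x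
  have hAle : A ≤ C' * Real.exp (-1 / θ) * N :=
    hxS.trans (mul_le_mul_of_nonneg_right
      (mul_le_mul_of_nonneg_right (le_max_left _ _) (Real.exp_pos _).le) hNpos.le)
  have hAN : A / N ≤ ε / 2 := by
    rw [div_le_iff₀ hNpos]
    calc A ≤ C' * Real.exp (-1 / θ) * N := hAle
      _ ≤ ε / 2 * N := mul_le_mul_of_nonneg_right hsmall hNpos.le
  have hAN0 : 0 ≤ A / N := div_nonneg hA0 hNpos.le
  rw [Real.dist_eq, hsplit, add_div] at hxK
  have hBeq : B / N - ℓ = (A / N + B / N - ℓ) - A / N := by ring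
  rw [hBeq]
  calc |A / N + B / N - ℓ - A / N| ≤ |A / N + B / N - ℓ| + |A / N| := by
        simpa only [sub_eq_add_neg, abs_neg] using abs_add_le (A / N + B / N - ℓ) (-(A / N))
    _ ≤ ε / 2 + ε / 2 := add_le_add hxK.le (by rw [abs_of_nonneg hAN0]; exact hAN)
    _ = ε := by ring

/-! ### Registered closed form -/

/-- **betaKernelLaw_of_roughKernelLaw** (registered closed form, `--supports stmt-Parity-11292`): for every
Bateman–Horn system `f` and real `y ≥ 1`, the smooth-kernel bound
`K^{sm}_x(y; ⌊x^θ⌋₊+1) ≤ C e^{−1/θ} x (log x)^{k(y−1)}` (all `θ ∈ (0,1]`, eventually in `x`) together with the rough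
law up to every `ε` for all small `θ` imply `BetaKernelLaw k f y`. [folklore] -/
theorem betaKernelLaw_of_roughKernelLaw : ∀ (k : ℕ) (f : Fin k → ℤ[X]), IsBatemanHornSystem f → ∀ y : ℝ, 1 ≤ y → (∃ C : ℝ, ∀ θ : ℝ, 0 < θ → θ ≤ 1 → ∀ᶠ x : ℕ in atTop, (∑ n ∈ Finset.range (x + 1), ∑ d ∈ (tuples f n).filter (fun d => x < ∏ i, d i ∧ (∏ i, d i) ∈ Nat.smoothNumbers (⌊(x : ℝ) ^ θ⌋₊ + 1)), ∏ i, thinWeight y (d i)) ≤ C * Real.exp (-1 / θ) * ((x : ℝ) * Real.log x ^ ((k : ℝ) * (y - 1)))) → (∀ ε : ℝ, 0 < ε → ∃ θ₀ : ℝ, 0 < θ₀ ∧ ∀ θ : ℝ, 0 < θ → θ ≤ θ₀ → ∀ᶠ x : ℕ in atTop, |(∑ n ∈ Finset.range (x + 1), ∑ d ∈ (tuples f n).filter (fun d => x < ∏ i, d i ∧ (∏ i, d i) ∉ Nat.smoothNumbers (⌊(x : ℝ) ^ θ⌋₊ + 1)), ∏ i, thinWeight y (d i)) / ((x : ℝ)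 * Real.log x ^ ((k : ℝ) * (y - 1))) - (eulerFactor f (y : ℂ)).re * (Real.exp ((y - 1) * Real.log (∏ i, ((f i).natDegree : ℝ))) * (Real.Gamma y)⁻¹ ^ k - (Real.Gamma ((k : ℝ) * (y - 1) + 1))⁻¹)| ≤ ε) → BetaKernelLaw k f y :=
  fun _k _f hf _y hy hS hR => betaKernelLaw_of_roughLaw hf hy hS hR

end

end Summit.Parity.BatemanHorn.Cruxes.SystemLSDRealSegment.BetaThinnedRootKernel
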